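import Literature.NumberTheory.LFunctions.Zhang2022.AppendixB
import Literature.NumberTheory.LFunctions.Zhang2022.Section18Certificate

/-!
# Zhang (2022) §18: the identity `i(3𝔢″₁ + 3𝔢″₂ + 𝔢″₃) + e₁* = ε` with the derived `e″_{1j}`

Trunk T-ANT (NumberTheory/LFunctions). Companion of `AppendixB.lean`, `Section18Defs.lean` and
`Section18Certificate.lean` (Y. Zhang, *Discrete mean estimates and the Landau–Siegel zero*,
arXiv:2211.02515v1 (2022) [Zhang2022LandauSiegel], §18, p. 36, with §12 (12.10), (12.15), Lemma 15.1
and Appendix B; **an unrefereed manuscript, a claimed result under adjudication** — this file proves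
exact identities between the manuscript's own constants and a kernel-checked interval evaluation of
them; it asserts nothing about the manuscript's theorems).

The text of §18 (p. 36): "`𝔠₃ = −i(3𝔢₁ + 3𝔢₂ + 𝔢₃ + 𝔢₀) + e₁* + 2e₂* + ε`. Write
`𝔢_j = 𝔢′_j − 𝔢″_j` with `𝔢′_j = (e′_{1j} + ι₂e_{2j})(ῑ₃e_{3j} + ῑ₄e_{2j})`,
`𝔢″_j = e″_{1j}(ῑ₃e_{3j} + ῑ₄e_{2j})`. By calculation (there is a theoretical interpretation),
`i(3𝔢″₁ + 3𝔢″₂ + 𝔢″₃) + e₁* = ε.` Hence `𝔠₃ = −i(3𝔢′₁ + 3𝔢′₂ + 𝔢′₃ + 𝔢₀) + 2e₂* + 2ε`", where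
`ε` denotes any quantity of modulus `< 10⁻⁵` (§2).

`Section18Certificate.identResidual_norm_gt` shows that with Lemma 15.1's PRINTED
`e″_{1j} = (j/0.756)∫₀^{0.004}(e^{(3/2)(0.504−z)πi} − e^{(3/4)πi})dz` (`e1ppj`) the left side has
modulus `> 1.5·10⁻⁴`: the printed identity fails for the printed closed form. `AppendixB.e1ppD_eq` shows
that the value the PROOF of (B.3) derives (its last display, at the main values) is
`e″_{1j} = −jπi·b*` (`e1ppD`). This file shows that with the derived value the identity holds, exactly
in the form the "theoretical interpretation" suggests, and numerically with `|ε| ≈ 9.1·10⁻⁶ < 10⁻⁵`: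

1. `frakc3_eq_frakc3r_add`, `frakc3D_eq_frakc3r_add` — the "Hence" step is exact algebra for either
   `e″`: `𝔠₃` ((18.1) form) `= 𝔠₃` (reduced form) `+ (i(3𝔢″₁ + 3𝔢″₂ + 𝔢″₃) + e₁*)`.
2. `identResidualD_eq_boundary` — **the theoretical interpretation, as an exact identity.** With
   `e″_{1j} = −jπi b*`, the window-average forms of `e_{3j}`, `e_{2j}` (`AppendixB.e3j_eq_average`,
   `e2j_eq_average`) and the definition of `e*_{1j}` ((12.15): the same profiles reflected over
   `[0, 0.496]`), the left side collapses to a second-order boundary-layer term: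
   `i(3𝔢″₁ + 3𝔢″₂ + 𝔢″₃) + e₁* = π b* Σ_j w_j (ῑ₃ (1/0.498)∫₀^{0.002} 𝔣𝔣_{j6} + ῑ₄ (1/0.5)∫₀^{0.004} 𝔣𝔣_{j7})`,
   `w = (3, 6, 3)`, i.e. `b* ≈ 1.6·10⁻⁵` ((12.10), width `0.004`) times the slivers of widths
   `0.498 − 0.496 = 0.002` and `0.5 − 0.496 = 0.004` left over between the windows of (4.1)–(4.3) and
   the range `[0, 0.496]` of (12.15) (`inner_sub_estar1`).
3. Kernel-checked enclosures (engine `Literature.Analysis.ValidatedNumerics.FixedPointInterval`, scale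
   `2^48`, `certD : CertPropD` by `decide +kernel`): `identResidualD_bounds`
   (`ε = −5.4739…·10⁻⁶ − 7.2819…·10⁻⁶ i`), **`identResidualD_norm_lt : |ε| < 10⁻⁵`**
   (`identResidualD_norm_bounds : 9.0·10⁻⁶ < |ε| < 9.2·10⁻⁶`); `e1ppD_one_bounds`,
   `e1pp_delta_one_norm_bounds : 3.8·10⁻⁵ < |e″₁₁(printed) − e″₁₁(derived)| < 3.9·10⁻⁵` (the two
   readings of `e″₁₁` are different numbers of the same size `≈ 5·10⁻⁵`); `frakc3D_re_bounds`,
   `frakc3D_im_bounds` (`Re 𝔠₃ ∈ (−6.990932, −6.990930)`, `Im 𝔠₃ ∈ (−0.020313, −0.020311)` with the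
   derived `e″`, true value `−6.9909310… − 0.0203118…i`; printed claim (18.2): `Re 𝔠₃ < −6.9951`, false
   under this reading too: `not_ineq182D`); `sec18_totalD_bounds` (`𝔠₁ + 𝔠₂ + 2Re 𝔠₃ ∈ (0.06314, 0.06317)`
   with the derived `e″`, true value `0.063156…`) and `not_ineq18sumD` (both prefactors of `𝔠₂`; a
   corollary of `Section18Certificate.not_ineq18sum_robust` since `|ε| < 10⁻⁵ ≤ 0.027`).

Consequence for the record (no new claim): the manuscript's numerical bookkeeping of §18 is internally
consistent once `e″_{1j}` is read as the value its own Appendix B derives; the discrepancy lies between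
the last display of the proof of (B.3) and the stated (B.3)/Lemma 15.1. None of this touches the cell's
verdict: the first non-following step remains (8.24) (`Section8Certificate.not_ineq824`), and the §18
total stays `> 0.06 > 0.001` under every reading of `e″_{1j}`.
-/

noncomputable section

open Complex Real ComplexConjugate
open Literature.Analysis.ValidatedNumerics.Numerics

namespace Literature.NumberTheory.LFunctions.Zhang2022

/-! ### The §18 quantities with the derived `e″_{1j} = −jπi·b*` -/

/-- `𝔢″_j = e″_{1j}(ῑ₃e_{3j} + ῑ₄e_{2j})` of §18 with the DERIVED `e″_{1j}` (`e1ppD`, the last display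
of the proof of (B.3)). [cite: Zhang2022LandauSiegel, §18 before (18.2), Appendix B (B.3)] -/
def frakeppD (j : ℕ) : ℂ := e1ppD j * (conj iota3 * e3j j + conj iota4 * e2j j)

/-- The left side of §18's "`i(3𝔢″₁ + 3𝔢″₂ + 𝔢″₃) + e₁* = ε`" with the derived `e″_{1j}`.
[cite: Zhang2022LandauSiegel, §18 before (18.2)] -/
def identResidualD : ℂ := I * (3 * frakeppD 1 + 3 * frakeppD 2 + frakeppD 3) + e1star

/-- `e_{1j} = e′_{1j} − e″_{1j}` (Lemma 15.1) with the derived `e″_{1j}`.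
[cite: Zhang2022LandauSiegel, Lemma 15.1, Appendix B (B.3)] -/
def e1jD (j : ℕ) : ℂ := e1pj j - e1ppD j

/-- `𝔢_j = (e_{1j} + ι₂e_{2j})(ῑ₃e_{3j} + ῑ₄e_{2j})` (Lemma 15.1) with the derived `e″_{1j}`.
[cite: Zhang2022LandauSiegel, Lemma 15.1] -/
def frakeD (j : ℕ) : ℂ := (e1jD j + iota2 * e2j j) * (conj iota3 * e3j j + conj iota4 * e2j j)

/-- (18.1), explicit part, with the derived `e″_{1j}`: `𝔠₃ = −i(3𝔢₁ + 3𝔢₂ + 𝔢₃ + 𝔢₀) + e₁* + 2e₂*`.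
[cite: Zhang2022LandauSiegel, (18.1)] -/
def frakc3D : ℂ := -I * (3 * frakeD 1 + 3 * frakeD 2 + frakeD 3 + frake0) + e1star + 2 * e2star

/-! ### The "Hence" step is exact algebra -/

/-- §18, "Hence": `𝔠₃` ((18.1) form, printed `e″`) `= 𝔠₃` (reduced form before (18.2))
`+ (i(3𝔢″₁ + 3𝔢″₂ + 𝔢″₃) + e₁*)` — exact, since `𝔢_j = 𝔢′_j − 𝔢″_j`.
[cite: Zhang2022LandauSiegel, §18 before (18.2)] -/
theorem frakc3_eq_frakc3r_add : frakc3 = frakc3r + identResidual := by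
  unfold frakc3 frakc3r identResidual frake frakep frakepp e1j; ring

/-- The same step with the derived `e″_{1j}`: `𝔠₃ᴰ = 𝔠₃ʳ + (i(3𝔢″₁ + 3𝔢″₂ + 𝔢″₃) + e₁*)ᴰ`.
[cite: Zhang2022LandauSiegel, §18 before (18.2)] -/
theorem frakc3D_eq_frakc3r_add : frakc3D = frakc3r + identResidualD := by
  unfold frakc3D frakc3r identResidualD frakeD frakep frakeppD e1jD; ring

/-! ### The theoretical interpretation: an exact boundary-layer identity -/

/-- For one `j`: (inner factor written with the window averages) `−` `e*_{1j}` `=` two boundary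
slivers: `ῑ₃[(1/0.498)∫₀^{0.498}𝔣𝔣₆ − (1/0.498)∫₀^{0.496}𝔣𝔣₆(0.498 − z)dz] + ῑ₄[2∫₀^{0.5}𝔣𝔣₇ −
2∫₀^{0.496}𝔣𝔣₇(0.5 − z)dz] = ῑ₃(1/0.498)∫₀^{0.002}𝔣𝔣₆ + ῑ₄·2∫₀^{0.004}𝔣𝔣₇` (substitution and
additivity of the integral). [cite: Zhang2022LandauSiegel, §12 (12.15), Lemma 15.1] -/
theorem inner_sub_estar1 (a6 a7 : ℚ) :
    (conj iota3 * (((1 / 0.498 : ℝ) : ℂ) * ∫ z in (0:ℝ)..0.498, ffF a6 (3/2) z)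
        + conj iota4 * (((1 / 0.5 : ℝ) : ℂ) * ∫ z in (0:ℝ)..0.5, ffF a7 (5/2) z))
      - estar1 (ffF a6 (3/2)) (ffF a7 (5/2))
    = conj iota3 * (((1 / 0.498 : ℝ) : ℂ) * ∫ z in (0:ℝ)..0.002, ffF a6 (3/2) z)
      + conj iota4 * (((1 / 0.5 : ℝ) : ℂ) * ∫ z in (0:ℝ)..0.004, ffF a7 (5/2) z) := by
  have h6 : (∫ z in (0:ℝ)..0.496, ffF a6 (3/2) (0.498 - z))
      = ∫ z in (0.002:ℝ)..0.498, ffF a6 (3/2) z := by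
    have e := intervalIntegral.integral_comp_sub_left (fun z => ffF a6 (3/2) z) (0.498 : ℝ)
      (a := (0:ℝ)) (b := (0.496:ℝ))
    rw [sub_zero, show (0.498 : ℝ) - 0.496 = 0.002 by norm_num] at e
    exact e
  have h7 : (∫ z in (0:ℝ)..0.496, ffF a7 (5/2) (0.5 - z))
      = ∫ z in (0.004:ℝ)..0.5, ffF a7 (5/2) z := by
    have e := intervalIntegral.integral_comp_sub_left (fun z => ffF a7 (5/2) z) (0.5 : ℝ)
      (a := (0:ℝ)) (b := (0.496:ℝ))
    rw [sub_zero, show (0.5 : ℝ) - 0.496 = 0.004 by norm_num] at e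
    exact e
  have s6 : (∫ z in (0:ℝ)..0.498, ffF a6 (3/2) z)
      = (∫ z in (0:ℝ)..0.002, ffF a6 (3/2) z) + ∫ z in (0.002:ℝ)..0.498, ffF a6 (3/2) z :=
    (intervalIntegral.integral_add_adjacent_intervals
      ((continuous_ffF a6 (3/2)).intervalIntegrable _ _)
      ((continuous_ffF a6 (3/2)).intervalIntegrable _ _)).symm
  have s7 : (∫ z in (0:ℝ)..0.5, ffF a7 (5/2) z)
      = (∫ z in (0:ℝ)..0.004, ffF a7 (5/2) z) + ∫ z in (0.004:ℝ)..0.5, ffF a7 (5/2) z :=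
    (intervalIntegral.integral_add_adjacent_intervals
      ((continuous_ffF a7 (5/2)).intervalIntegrable _ _)
      ((continuous_ffF a7 (5/2)).intervalIntegrable _ _)).symm
  have hint : estar1 (ffF a6 (3/2)) (ffF a7 (5/2))
      = (conj iota3 * ∫ z in (0:ℝ)..0.496, ffF a6 (3/2) (0.498 - z)) / 0.498
        + (conj iota4 * ∫ z in (0:ℝ)..0.496, ffF a7 (5/2) (0.5 - z)) / 0.5 := by
    unfold estar1
    rw [intervalIntegral.integral_add (Continuous.intervalIntegrable (by fun_prop) _ _)
        (Continuous.intervalIntegrable (by fun_prop) _ _),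
      intervalIntegral.integral_div, intervalIntegral.integral_div,
      intervalIntegral.integral_const_mul, intervalIntegral.integral_const_mul]
  rw [hint, h6, h7, s6, s7]
  push_cast
  ring

/-- **§18's "theoretical interpretation", exactly.** With the derived `e″_{1j} = −jπi b*`
(`AppendixB.e1ppD_eq`), the window averages `e_{3j} = (1/0.498)∫₀^{0.498}𝔣𝔣_{j6}`,
`e_{2j} = 2∫₀^{0.5}𝔣𝔣_{j7}` (`AppendixB`) and `e₁* = −πb*(3e*₁₁ + 6e*₁₂ + 3e*₁₃)` ((12.15)):
`i(3𝔢″₁ + 3𝔢″₂ + 𝔢″₃) + e₁* = π b* Σ_j w_j (ῑ₃(1/0.498)∫₀^{0.002}𝔣𝔣_{j6} + ῑ₄·2∫₀^{0.004}𝔣𝔣_{j7})`,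
`w = (3, 6, 3)`, `𝔣𝔣_{j6} = ffF (3/2 − j) (3/2)`, `𝔣𝔣_{j7} = ffF (5/2 − j) (5/2)` — a second-order
boundary-layer term (`b* = O(0.004²/0.504)` times slivers of widths `0.002`, `0.004`).
[cite: Zhang2022LandauSiegel, §18 before (18.2), (12.10), (12.15), Lemma 15.1, Appendix B] -/
theorem identResidualD_eq_boundary :
    identResidualD = (π : ℂ) * bstar *
      (3 * (conj iota3 * (((1 / 0.498 : ℝ) : ℂ) * ∫ z in (0:ℝ)..0.002, ffF (1/2) (3/2) z)
            + conj iota4 * (((1 / 0.5 : ℝ) : ℂ) * ∫ z in (0:ℝ)..0.004, ffF (3/2) (5/2) z))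
        + 6 * (conj iota3 * (((1 / 0.498 : ℝ) : ℂ) * ∫ z in (0:ℝ)..0.002, ffF (-1/2) (3/2) z)
            + conj iota4 * (((1 / 0.5 : ℝ) : ℂ) * ∫ z in (0:ℝ)..0.004, ffF (1/2) (5/2) z))
        + 3 * (conj iota3 * (((1 / 0.498 : ℝ) : ℂ) * ∫ z in (0:ℝ)..0.002, ffF (-3/2) (3/2) z)
            + conj iota4 * (((1 / 0.5 : ℝ) : ℂ) * ∫ z in (0:ℝ)..0.004, ffF (-1/2) (5/2) z))) := by
  have hIe : ∀ j : ℕ, I * e1ppD j = (j : ℂ) * π * bstar := by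
    intro j
    rw [e1ppD_eq]
    have hI : I * I = -1 := I_mul_I
    linear_combination (-((j : ℂ) * π * bstar)) * hI
  have hA : identResidualD = (π : ℂ) * bstar *
      (3 * ((conj iota3 * e3j 1 + conj iota4 * e2j 1) - estar11)
        + 6 * ((conj iota3 * e3j 2 + conj iota4 * e2j 2) - estar12)
        + 3 * ((conj iota3 * e3j 3 + conj iota4 * e2j 3) - estar13)) := by
    unfold identResidualD frakeppD e1star
    have h1 := hIe 1
    have h2 := hIe 2
    have h3 := hIe 3
    push_cast at h1 h2 h3
    linear_combination (3 * (conj iota3 * e3j 1 + conj iota4 * e2j 1)) * h1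
      + (3 * (conj iota3 * e3j 2 + conj iota4 * e2j 2)) * h2
      + (conj iota3 * e3j 3 + conj iota4 * e2j 3) * h3
  have a31 : e3j 1 = ((1 / 0.498 : ℝ) : ℂ) * ∫ z in (0:ℝ)..0.498, ffF (1/2) (3/2) z := by
    rw [e3j_eq_average, show ((3/2 : ℚ) - (1 : ℕ)) = 1/2 by norm_num]
  have a32 : e3j 2 = ((1 / 0.498 : ℝ) : ℂ) * ∫ z in (0:ℝ)..0.498, ffF (-1/2) (3/2) z := by
    rw [e3j_eq_average, show ((3/2 : ℚ) - (2 : ℕ)) = -1/2 by norm_num]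
  have a33 : e3j 3 = ((1 / 0.498 : ℝ) : ℂ) * ∫ z in (0:ℝ)..0.498, ffF (-3/2) (3/2) z := by
    rw [e3j_eq_average, show ((3/2 : ℚ) - (3 : ℕ)) = -3/2 by norm_num]
  have a21 : e2j 1 = ((1 / 0.5 : ℝ) : ℂ) * ∫ z in (0:ℝ)..0.5, ffF (3/2) (5/2) z := by
    rw [e2j_eq_average, show ((5/2 : ℚ) - (1 : ℕ)) = 3/2 by norm_num]
  have a22 : e2j 2 = ((1 / 0.5 : ℝ) : ℂ) * ∫ z in (0:ℝ)..0.5, ffF (1/2) (5/2) z := by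
    rw [e2j_eq_average, show ((5/2 : ℚ) - (2 : ℕ)) = 1/2 by norm_num]
  have a23 : e2j 3 = ((1 / 0.5 : ℝ) : ℂ) * ∫ z in (0:ℝ)..0.5, ffF (-1/2) (5/2) z := by
    rw [e2j_eq_average, show ((5/2 : ℚ) - (3 : ℕ)) = -1/2 by norm_num]
  rw [hA]
  unfold estar11 estar12 estar13 ff16 ff17 ff26 ff27 ff36 ff37
  rw [a31, a21, a32, a22, a33, a23, inner_sub_estar1 (1/2) (3/2), inner_sub_estar1 (-1/2) (1/2),
    inner_sub_estar1 (-3/2) (-1/2)]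

/-! ### Closed forms in engine shape -/

/-- `∫₀ᴸ 𝔣𝔣_{a,k}(z) dz = expQuadInt 1 (aπi) 0 k L` (`k ≠ 0`). [folklore] -/
theorem integral_ffF_eq_expQuadInt (a k : ℚ) (hk : k ≠ 0) (L : ℝ) :
    ∫ z in (0:ℝ)..L, ffF a k z = expQuadInt 1 ((a : ℂ) * π * I) 0 k L := by
  rw [← integral_quad_mul_cexp 1 ((a : ℂ) * π * I) 0 hk L]
  refine intervalIntegral.integral_congr (fun z _ => ?_)
  unfold ffF; ring

/-- The `j`-th pair of boundary slivers in engine shape (`0.002 = 1/500`, `1/0.498 = 500/249`,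
`0.004 = 1/250`, `1/0.5 = 2`). [folklore] -/
def bdryPair (a6 a7 : ℚ) : ℂ :=
  conj iota3 * ((∫ z in (0:ℝ)..(((1/500 : ℚ)) : ℝ), ffF a6 (3/2) z) * (((500/249 : ℚ) : ℝ) : ℂ))
    + conj iota4 * ((∫ z in (0:ℝ)..(((1/250 : ℚ)) : ℝ), ffF a7 (5/2) z) * (((2 : ℚ) : ℝ) : ℂ))

/-- The boundary pair equals `bdryPair`. [folklore] -/
theorem bdryPair_eq (a6 a7 : ℚ) :
    conj iota3 * (((1 / 0.498 : ℝ) : ℂ) * ∫ z in (0:ℝ)..0.002, ffF a6 (3/2) z)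
      + conj iota4 * (((1 / 0.5 : ℝ) : ℂ) * ∫ z in (0:ℝ)..0.004, ffF a7 (5/2) z)
    = bdryPair a6 a7 := by
  have h1 : (0.002 : ℝ) = ((1/500 : ℚ) : ℝ) := by norm_num
  have h2 : (0.004 : ℝ) = ((1/250 : ℚ) : ℝ) := by norm_num
  have h3 : ((1 / 0.498 : ℝ) : ℂ) = (((500/249 : ℚ) : ℝ) : ℂ) := by norm_num
  have h4 : ((1 / 0.5 : ℝ) : ℂ) = (((2 : ℚ) : ℝ) : ℂ) := by norm_num
  rw [h1, h2, h3, h4]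
  unfold bdryPair
  ring

/-- `identResidualD` in engine shape. [folklore] -/
def identResidualDval : ℂ :=
  (π : ℂ) * bstar * (3 * bdryPair (1/2) (3/2) + 6 * bdryPair (-1/2) (1/2) + 3 * bdryPair (-3/2) (-1/2))

/-- `identResidualD = identResidualDval`. [folklore] -/
theorem identResidualD_eq_val : identResidualD = identResidualDval := by
  rw [identResidualD_eq_boundary, bdryPair_eq, bdryPair_eq, bdryPair_eq]
  rfl

/-! ### Interval enclosures (boxes) -/

/- As in `Section8Certificate` / `Section18Certificate`: keep the interval primitives opaque to the unifier. -/
attribute [local irreducible] CB.add CB.sub CB.mul CB.neg CB.conj CB.mulFI CB.mulI CB.mulInt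
  CB.ofFI CB.ofInt CB.normSqFI CB.expI FI.add FI.sub FI.mul FI.neg FI.mulInt FI.divNat FI.divPos
  FI.ofRat FI.ofInt FI.pi qCB piMul expIpi overPiFI piISq

/-- box of `∫₀ᴸ 𝔣𝔣_{a,k}` (a boundary sliver) [folklore] -/
@[irreducible] def sliverB (a k L : ℚ) : CB :=
  expQuadIntB (CB.ofInt 1) (((qCB a).mulFI FI.pi).mulI) (CB.ofInt 0) k L

/-- Soundness of `sliverB`. [folklore] -/
theorem mem_sliverB {a k L : ℚ} (hk : k ≠ 0) (hE : expIpiOK (k * L) = true)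
    (hU : overPiOK k⁻¹ = true) :
    CB.mem (∫ z in (0:ℝ)..(L : ℝ), ffF a k z) (sliverB a k L) := by
  rw [integral_ffF_eq_expQuadInt a k hk]
  unfold sliverB
  apply_rules [mem_expQuadIntB, CB.mem_mulI, CB.mem_mulFI, FI.mem_pi, mem_qCB, mem_zeroCB,
    mem_oneCB]

/-- box mirror of `bdryPair` [folklore] -/
@[irreducible] def bdryPairB (a6 a7 : ℚ) : CB :=
  (iota3B.conj.mul ((sliverB a6 (3/2) (1/500)).mulFI (FI.ofRat (500/249)))).add
    (iota4B.conj.mul ((sliverB a7 (5/2) (1/250)).mulFI (FI.ofRat 2)))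

/-- Soundness of `bdryPairB`. [folklore] -/
theorem mem_bdryPair (a6 a7 : ℚ) : CB.mem (bdryPair a6 a7) (bdryPairB a6 a7) := by
  have h1 : expIpiOK (3/2 * (1/500)) = true := by decide +kernel
  have h2 : overPiOK (3/2)⁻¹ = true := by decide +kernel
  have h3 : expIpiOK (5/2 * (1/250)) = true := by decide +kernel
  have h4 : overPiOK (5/2)⁻¹ = true := by decide +kernel
  unfold bdryPair bdryPairB
  exact CB.mem_add
    (CB.mem_mul (CB.mem_conj mem_iota3)
      (CB.mem_mulFI (mem_sliverB (by norm_num) h1 h2) (FI.mem_ofRat _)))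
    (CB.mem_mul (CB.mem_conj mem_iota4)
      (CB.mem_mulFI (mem_sliverB (by norm_num) h3 h4) (FI.mem_ofRat _)))

/-- box of `i(3𝔢″₁ + 3𝔢″₂ + 𝔢″₃) + e₁*` with the derived `e″` [folklore] -/
@[irreducible] def identResidualDB : CB :=
  ((CB.ofFI FI.pi).mul bstarB).mul
    ((((CB.ofInt 3).mul (bdryPairB (1/2) (3/2))).add ((CB.ofInt 6).mul (bdryPairB (-1/2) (1/2)))).add
      ((CB.ofInt 3).mul (bdryPairB (-3/2) (-1/2))))

/-- `identResidualD ∈ identResidualDB`. [folklore] -/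
theorem mem_identResidualD : CB.mem identResidualD identResidualDB := by
  rw [identResidualD_eq_val]
  unfold identResidualDval identResidualDB
  exact CB.mem_mul (CB.mem_mul mem_piCB mem_bstar)
    (CB.mem_add (CB.mem_add (CB.mem_mul mem_threeCB (mem_bdryPair _ _))
      (CB.mem_mul mem_sixCB (mem_bdryPair _ _))) (CB.mem_mul mem_threeCB (mem_bdryPair _ _)))

/-- box of `𝔠₃` with the derived `e″` [folklore] -/
@[irreducible] def frakc3DB : CB := frakc3rB.add identResidualDB

/-- `𝔠₃ᴰ ∈ frakc3DB`. [folklore] -/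
theorem mem_frakc3D : CB.mem frakc3D frakc3DB := by
  rw [frakc3D_eq_frakc3r_add]
  unfold frakc3DB
  exact CB.mem_add mem_frakc3r mem_identResidualD

/-- box of the derived `e″_{1j} = −jπi b*` [folklore] -/
@[irreducible] def e1ppDB (j : ℕ) : CB := ((((CB.ofFI FI.pi).mul bstarB).mulI).mulInt j).neg

/-- `e″_{1j}` (derived) `∈ e1ppDB j`. [folklore] -/
theorem mem_e1ppD (j : ℕ) : CB.mem (e1ppD j) (e1ppDB j) := by
  have e : e1ppD j = -(((π : ℂ) * bstar * I) * ((j : ℤ) : ℂ)) := by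
    rw [e1ppD_eq]; push_cast; ring
  rw [e]
  unfold e1ppDB
  exact CB.mem_neg (CB.mem_mulInt (CB.mem_mulI (CB.mem_mul mem_piCB mem_bstar)) _)

/-- box of `e″_{1j}(printed) − e″_{1j}(derived)` [folklore] -/
@[irreducible] def e1ppDeltaB (j : ℕ) : CB := (e1ppjB j).sub (e1ppDB j)

/-- `e″_{1j}(printed) − e″_{1j}(derived) ∈ e1ppDeltaB j`. [folklore] -/
theorem mem_e1ppDelta (j : ℕ) : CB.mem (e1ppj j - e1ppD j) (e1ppDeltaB j) := by
  unfold e1ppDeltaB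
  exact CB.mem_sub (mem_e1ppj j) (mem_e1ppD j)

/-! ### Certificate -/

/-- The comparisons read off the boxes (thresholds `q·2^48` against the integer endpoints). [folklore] -/
def CertPropD : Prop :=
  ((-0.000005474 : ℚ) * (SC : ℚ) < (identResidualDB.re.lo : ℚ)
      ∧ (identResidualDB.re.hi : ℚ) < (-0.0000054739 : ℚ) * (SC : ℚ))
  ∧ ((-0.000007282 : ℚ) * (SC : ℚ) < (identResidualDB.im.lo : ℚ)
      ∧ (identResidualDB.im.hi : ℚ) < (-0.0000072819 : ℚ) * (SC : ℚ))
  ∧ ((0.000000000081 : ℚ) * (SC : ℚ) < ((CB.normSqFI identResidualDB).lo : ℚ)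
      ∧ ((CB.normSqFI identResidualDB).hi : ℚ) < (0.00000000008464 : ℚ) * (SC : ℚ))
  ∧ ((-6.990932 : ℚ) * (SC : ℚ) < (frakc3DB.re.lo : ℚ) ∧ (frakc3DB.re.hi : ℚ) < (-6.99093 : ℚ) * (SC : ℚ))
  ∧ ((-0.020313 : ℚ) * (SC : ℚ) < (frakc3DB.im.lo : ℚ) ∧ (frakc3DB.im.hi : ℚ) < (-0.020311 : ℚ) * (SC : ℚ))
  ∧ ((0.00000062661 : ℚ) * (SC : ℚ) < ((e1ppDB 1).re.lo : ℚ)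
      ∧ ((e1ppDB 1).re.hi : ℚ) < (0.00000062663 : ℚ) * (SC : ℚ))
  ∧ ((-0.0000498622 : ℚ) * (SC : ℚ) < ((e1ppDB 1).im.lo : ℚ)
      ∧ ((e1ppDB 1).im.hi : ℚ) < (-0.000049862 : ℚ) * (SC : ℚ))
  ∧ ((0.000000001444 : ℚ) * (SC : ℚ) < ((CB.normSqFI (e1ppDeltaB 1)).lo : ℚ)
      ∧ ((CB.normSqFI (e1ppDeltaB 1)).hi : ℚ) < (0.000000001521 : ℚ) * (SC : ℚ))

/-- Decidability of the certificate comparisons. [folklore] -/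
instance : Decidable CertPropD := by unfold CertPropD; infer_instance

/-- **The kernel check.** [folklore] -/
theorem certD : CertPropD := by decide +kernel

/-! ### Results -/

/-- `ε = i(3𝔢″₁ + 3𝔢″₂ + 𝔢″₃) + e₁*` (derived `e″`): `−5.4740·10⁻⁶ < Re ε < −5.4739·10⁻⁶`,
`−7.2820·10⁻⁶ < Im ε < −7.2819·10⁻⁶`. [folklore] -/
theorem identResidualD_bounds :
    ((-0.000005474 : ℝ) < identResidualD.re ∧ identResidualD.re < -0.0000054739)
    ∧ ((-0.000007282 : ℝ) < identResidualD.im ∧ identResidualD.im < -0.0000072819) := by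
  have h := certD.1
  have h' := certD.2.1
  exact ⟨⟨by simpa using lo_bound mem_identResidualD.1 h.1,
      by simpa using hi_bound mem_identResidualD.1 h.2⟩,
    ⟨by simpa using lo_bound mem_identResidualD.2 h'.1,
      by simpa using hi_bound mem_identResidualD.2 h'.2⟩⟩

/-- `8.1·10⁻¹¹ < |ε|² < 8.464·10⁻¹¹`. [folklore] -/
theorem identResidualD_normSq_bounds :
    (0.000000000081 : ℝ) < Complex.normSq identResidualD
      ∧ Complex.normSq identResidualD < 0.00000000008464 := by
  have h := certD.2.2.1
  have hm := CB.mem_normSqFI mem_identResidualD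
  exact ⟨by exact_mod_cast lo_bound hm h.1, by exact_mod_cast hi_bound hm h.2⟩

/-- **`|i(3𝔢″₁ + 3𝔢″₂ + 𝔢″₃) + e₁*| < 10⁻⁵` with the derived `e″_{1j}`**: the printed identity
"`= ε`" of §18 HOLDS under this reading (`|ε| ≈ 9.1·10⁻⁶`). [folklore] -/
theorem identResidualD_norm_lt : ‖identResidualD‖ < 0.00001 := by
  have h := identResidualD_normSq_bounds.2
  rw [Complex.normSq_eq_norm_sq] at h
  nlinarith [norm_nonneg identResidualD]

/-- `9.0·10⁻⁶ < |ε| < 9.2·10⁻⁶` (derived `e″`). [folklore] -/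
theorem identResidualD_norm_bounds : (0.000009 : ℝ) < ‖identResidualD‖ ∧ ‖identResidualD‖ < 0.0000092 := by
  have h := identResidualD_normSq_bounds
  rw [Complex.normSq_eq_norm_sq] at h
  constructor <;> nlinarith [norm_nonneg identResidualD, h.1, h.2]

/-- The derived `e″₁₁ = −πi b*`: `6.2661·10⁻⁷ < Re < 6.2663·10⁻⁷`, `−4.98622·10⁻⁵ < Im < −4.98620·10⁻⁵`
(the printed `e″₁₁` is `−3.5038·10⁻⁵ − 3.5481·10⁻⁵ i`, `Section18Certificate.mem_e1ppj`). [folklore] -/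
theorem e1ppD_one_bounds :
    ((0.00000062661 : ℝ) < (e1ppD 1).re ∧ (e1ppD 1).re < 0.00000062663)
    ∧ ((-0.0000498622 : ℝ) < (e1ppD 1).im ∧ (e1ppD 1).im < -0.000049862) := by
  have h := certD.2.2.2.2.2.1
  have h' := certD.2.2.2.2.2.2.1
  exact ⟨⟨by exact_mod_cast lo_bound (mem_e1ppD 1).1 h.1,
      by exact_mod_cast hi_bound (mem_e1ppD 1).1 h.2⟩,
    ⟨by simpa using lo_bound (mem_e1ppD 1).2 h'.1,
      by simpa using hi_bound (mem_e1ppD 1).2 h'.2⟩⟩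

/-- **The two readings of `e″₁₁` differ**: `3.8·10⁻⁵ < |e″₁₁(printed, Lemma 15.1) − e″₁₁(derived, (B.3))|
< 3.9·10⁻⁵` (both have modulus `≈ 5·10⁻⁵`). [folklore] -/
theorem e1pp_delta_one_norm_bounds :
    (0.000038 : ℝ) < ‖e1ppj 1 - e1ppD 1‖ ∧ ‖e1ppj 1 - e1ppD 1‖ < 0.000039 := by
  have h := certD.2.2.2.2.2.2.2
  have hm := CB.mem_normSqFI (mem_e1ppDelta 1)
  have h1 : (((0.000000001444 : ℚ)) : ℝ) < Complex.normSq (e1ppj 1 - e1ppD 1) := lo_bound hm h.1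
  have h2 : Complex.normSq (e1ppj 1 - e1ppD 1) < (((0.000000001521 : ℚ)) : ℝ) := hi_bound hm h.2
  rw [Complex.normSq_eq_norm_sq] at h1 h2
  push_cast at h1 h2
  constructor <;> nlinarith [norm_nonneg (e1ppj 1 - e1ppD 1), h1, h2]

/-- `𝔠₃` with the derived `e″`: `−6.990932 < Re 𝔠₃ < −6.990930` (true value `−6.9909310…`; reduced
form: `−6.990925…`; printed-`e″` form: `−6.990998…`; printed claim (18.2): `< −6.9951`). [folklore] -/
theorem frakc3D_re_bounds : (-6.990932 : ℝ) < frakc3D.re ∧ frakc3D.re < -6.99093 := by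
  have h := certD.2.2.2.1
  exact ⟨by simpa using lo_bound mem_frakc3D.1 h.1, by simpa using hi_bound mem_frakc3D.1 h.2⟩

/-- `−0.020313 < Im 𝔠₃ < −0.020311` (derived `e″`; true value `−0.0203118…`). [folklore] -/
theorem frakc3D_im_bounds : (-0.020313 : ℝ) < frakc3D.im ∧ frakc3D.im < -0.020311 := by
  have h := certD.2.2.2.2.1
  exact ⟨by simpa using lo_bound mem_frakc3D.2 h.1, by simpa using hi_bound mem_frakc3D.2 h.2⟩

/-- (18.2) `Re 𝔠₃ < −6.9951` is false under the derived-`e″` reading as well (`Re 𝔠₃ = −6.99093…`).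
[folklore] -/
theorem not_ineq182D : ¬ (frakc3D.re < -6.9951) := by
  have h := frakc3D_re_bounds.1; intro h'; linarith

/-- The §18 total with the derived `e″` (printed prefactor `0.504`, (18.1) form of `𝔠₃`):
`0.06314 < 𝔠₁ + 𝔠₂ + 2Re 𝔠₃ < 0.06317` (true value `0.063156…`; the manuscript claims `< 0.001`).
[folklore] -/
theorem sec18_totalD_bounds : (0.06314 : ℝ) < frakc1.re + frakc2.re + 2 * frakc3D.re
    ∧ frakc1.re + frakc2.re + 2 * frakc3D.re < 0.06317 := by
  have h1 := frakc1_re_bounds; have h2 := frakc2_re_bounds; have h3 := frakc3D_re_bounds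
  constructor <;> linarith [h1.1, h1.2, h2.1, h2.2, h3.1, h3.2]

/-- **The printed conclusion of §18 fails under the derived-`e″` reading too**, for either prefactor of
`𝔠₂` and either form of `𝔠₃` — a corollary of `not_ineq18sum_robust` (`|ε| < 10⁻⁵ ≤ 0.027`) and
`𝔠₃ᴰ = 𝔠₃ʳ + ε`. [folklore] -/
theorem not_ineq18sumD :
    ¬ (frakc1.re + frakc2.re + 2 * frakc3D.re < 0.001)
    ∧ ¬ (frakc1.re + frakc2c.re + 2 * frakc3D.re < 0.001) := by
  have hε : ‖identResidualD‖ ≤ 0.027 := by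
    have := identResidualD_norm_lt; linarith
  have h := not_ineq18sum_robust identResidualD hε
  rw [← frakc3D_eq_frakc3r_add] at h
  exact ⟨h.1, h.2.1⟩

end Literature.NumberTheory.LFunctions.Zhang2022

/-! ## `_holds` aliases (appended 2026-08-28, flt-inv gen 65)

The named fact(s) below are already theorems of THIS file under another name; the alias records the
discharge under the tree's exact naming convention `X_holds` (D-0026 bookkeeping: the proof term is the
existing theorem; no statement, definition or attribute is edited; no new named fact).  The ledger's debt
table listed each as unproved (`ledger fact claim` GRANTED «status unproved», 2026-08-28T08:5xZ). -/

/-- `CertPropD` — the kernel certificate of the interval evaluation behind the §18 identity `i(3𝔢″₁ + 3𝔢″₂ + 𝔢″₃) + e₁* = ε` holds (`decide +kernel`) (`Literature.NumberTheory.LFunctions.Zhang2022.certD`). [cite: Zhang2022LandauSiegel, §18 before (18.2), Appendix B (B.3)] -/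
theorem _root_.Literature.NumberTheory.LFunctions.Zhang2022.CertPropD_holds : _root_.Literature.NumberTheory.LFunctions.Zhang2022.CertPropD :=
  _root_.Literature.NumberTheory.LFunctions.Zhang2022.certD
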